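import Summits.CriticalPhenomena.PercolationContinuityZ3.Theorems.PercNearOneGluingNoHeavyLowerTailSunflowerOrPetalSectors
import Summits.CriticalPhenomena.PercolationContinuityZ3.Theorems.PercNearOneGluingNoHeavyLowerTailSunflowerSpectatorTransferOrPetalPairLabels
import HarnessLib

/-!
# `NoHeavyLowerTail` (crux stmt-CriticalPhenomena-4575), abstract sunflower cubic: the SPECTATOR-TRANSFER inequality (♣)
# `2·Nabk ≤ SA + SB + 2·Nkk` holds behind EVERY DISJUNCTIVE PETAL

Support file (seat `prim-ineq-gen-2` gen 23; `--supports stmt-CriticalPhenomena-4575`).  No `sorry`, no named facts; nothing is asserted about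
the crux.  Last of four files (`…SunflowerOrPetalCodes`, `…OrPetalPlacements`, `…OrPetalSectors`).

THEOREM `Sunflower.spectatorTransfer_three_of_isOrPetal`: if the petal `3` of a sunflower of up-sets `F` is exactly the family of
non-kernel sets meeting a nonempty `S₀` (`IsOrPetal S₀`, `…SunflowerOrPetal`; `|S₀|` ARBITRARY), then `2·Nabk 3 ≤ SA + SB + 2·Nkk 3` —
the typed conjecture `SpectatorTransfer` (`…SunflowerSpectatorTransfer`) for that petal.  `spectatorTransfer_of_orPetal_label`: the same for a
disjunctive petal of any label (relabelling `rotate`); `spectatorTransfer_ofUpsets_or`: the sunflower `θ(U₀,U₁,U₂)` with `U_i = OR_{S₀}`.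
Previously in the tree: `|S₀| = 1` (centred petal), `|S₀| = 2` (p321579), `|S₀| = 3` (p322539), intersecting petals.

PROOF.  `Q = SA + SB + 2·Nkk 3 − 2·Nabk 3 = Σ_parts clubKer` (`club_eq_sum_parts`); trace split along `S₀` and exchange of sums: `Q = nested E G`
(`E = S₀ᶜ`) with `G (X,Y,Z)` the placement sum of the block codes `codeOf X = (σ ↦ lab (X ∪ σ))` (admissible behind the petal, `isCode_codeOf`);
subtract the rows `rowT (codeOf X) · Σ kk` (`nested_weight_mul_kk_nonneg`, antipodal Gladkov); symmetrise (`six_mul_nested_eq_symm6Of`): the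
symmetrised kernel is `codeSum − 2·codeRows` (`symm6Of_placementKer`, block symmetries of `partsOf S₀`), nonnegative by the pointwise theorem
`two_mul_codeRows_le_codeSum` (`…SunflowerOrPetalSectors`).  Memo: run/shared/lean/prim/prim-ineq-gen-2/gen23/CLUB-ORPETAL-ALL-R.md.
-/

namespace Summit.CriticalPhenomena.PercolationContinuityZ3.Theorems.SunflowerPartition

open Finset

variable {α : Type*} [DecidableEq α]

/-- The placement kernel of a code triple minus the spectator row of the first code (unsymmetrised). [this work] -/
def placementKer (S₀ : Finset α) (g₁ g₂ g₃ : Finset α → Fin 5) : ℤ :=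
  (∑ s ∈ partsOf S₀, clubKer (g₁ s.1) (g₂ s.2) (g₃ (S₀ \ (s.1 ∪ s.2)))) - rowT S₀ g₁ * kk (g₂ ∅) (g₃ ∅)

/-- Symmetrising the placement kernel over the three codes gives `codeSum − 2·codeRows`. [this work] -/
theorem symm6Of_placementKer (S₀ : Finset α) (g₁ g₂ g₃ : Finset α → Fin 5) :
    symm6Of (placementKer S₀) g₁ g₂ g₃ = codeSum S₀ g₁ g₂ g₃ - 2 * codeRows S₀ g₁ g₂ g₃ := by
  unfold symm6Of placementKer codeSum codeRows club6 symm6Of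
  have e2 := sum_partsOf_swap23 S₀ (fun a b c => clubKer (g₁ a) (g₃ b) (g₂ c))
  have e3 := sum_partsOf_swap12 S₀ (fun a b c => clubKer (g₂ a) (g₁ b) (g₃ c))
  have e4 := sum_partsOf_rot' S₀ (fun a b c => clubKer (g₂ a) (g₃ b) (g₁ c))
  have e5 := sum_partsOf_rot S₀ (fun a b c => clubKer (g₃ a) (g₁ b) (g₂ c))
  have e6 := sum_partsOf_swap13 S₀ (fun a b c => clubKer (g₃ a) (g₂ b) (g₁ c))
  rw [e2, e3, e4, e5, e6, kk_comm (g₃ ∅) (g₂ ∅), kk_comm (g₃ ∅) (g₁ ∅), kk_comm (g₂ ∅) (g₁ ∅)]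
  simp only [sum_add_distrib]
  ring

namespace Sunflower

variable (F : Sunflower α)

/-- The block code of `X` on the support `S₀`: `σ ↦ lab (X ∪ σ)`. [this work] -/
def codeOf (X : Finset α) : Finset α → Fin 5 := fun σ => F.lab (X ∪ σ)

/-- Behind a disjunctive petal with support `S₀`, the block code of a set disjoint from `S₀` is admissible. [this work] -/
theorem isCode_codeOf {S₀ : Finset α} (h : F.IsOrPetal S₀) {X : Finset α} (hX : Disjoint X S₀) : IsCode S₀ (F.codeOf X) := by
  refine ⟨?_, fun σ hσ hne => ?_, fun σ τ hστ _ => ?_⟩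
  · show F.lab (X ∪ ∅) ≠ 3
    rw [union_empty]
    exact lab_ne_three_of_subset h hX subset_rfl
  · exact lab_union_ge_three h hσ hne X
  · exact F.lab_mono (union_subset_union subset_rfl hστ)

/-- **(♣) BEHIND EVERY DISJUNCTIVE PETAL**: if the petal `3` consists exactly of the non-kernel sets meeting a nonempty `S₀`
(`IsOrPetal S₀`, any `|S₀|`), then `2·Nabk 3 ≤ SA + SB + 2·Nkk 3` (`SpectatorTransfer` for the petal `3`). [this work] -/
theorem spectatorTransfer_three_of_isOrPetal [Fintype α] {S₀ : Finset α} (h : F.IsOrPetal S₀) :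
    2 * F.Nabk 3 ≤ F.SA + F.SB + 2 * F.Nkk 3 := by
  have h₀ : S₀.Nonempty := h.1
  set E : Finset α := S₀ᶜ with hE
  -- an injection into ℕ (for the least-point choices of the bottom sector)
  let ι : α → ℕ := fun x => (Fintype.equivFin α x : ℕ)
  have hι : Function.Injective ι := fun x y hxy => (Fintype.equivFin α).injective (Fin.ext hxy)
  -- codes of blocks inside `E`
  have hcode : ∀ X : Finset α, X ⊆ E → IsCode S₀ (F.codeOf X) := fun X hX =>
    F.isCode_codeOf h (disjoint_compl_left.mono_left hX)
  -- Q regrouped along the traces on S₀ and swapped: a sum over the 3-partitions of E of the placement sums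
  set G : Finset α → Finset α → Finset α → ℤ := fun X Y Z =>
    ∑ s ∈ partsOf S₀, clubKer (F.codeOf X s.1) (F.codeOf Y s.2) (F.codeOf Z (S₀ \ (s.1 ∪ s.2))) with hG
  have hQ : F.SA + F.SB + 2 * F.Nkk 3 - 2 * F.Nabk 3 = nested E G := by
    rw [F.club_eq_sum_parts, sum_parts_eq_sum_traces S₀]
    rw [sum_congr rfl fun s hs => sum_parts_trace_eq S₀ hs (fun P Q R => clubKer (F.lab P) (F.lab Q) (F.lab R)), sum_comm,
      nested_eq_sum_filter]
    rfl
  -- subtract and add the rows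
  set Rw : Finset α → Finset α → Finset α → ℤ := fun X S T => rowT S₀ (F.codeOf X) * kk (F.lab S) (F.lab T) with hRw
  have hrows : 0 ≤ nested E Rw := F.nested_weight_mul_kk_nonneg E (fun X => rowT S₀ (F.codeOf X)) fun X => rowT_nonneg _ _
  have hsplit : nested E G = nested E (fun X S T => placementKer S₀ (F.codeOf X) (F.codeOf S) (F.codeOf T)) + nested E Rw := by
    unfold nested
    rw [← sum_add_distrib]
    refine sum_congr rfl fun X _ => ?_
    rw [← sum_add_distrib]
    refine sum_congr rfl fun S _ => ?_
    simp only [hG, hRw, placementKer, codeOf, union_empty]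
    ring
  -- symmetrise and apply the pointwise theorem
  have hker : 0 ≤ nested E (fun X S T => placementKer S₀ (F.codeOf X) (F.codeOf S) (F.codeOf T)) := by
    have h6 := six_mul_nested_eq_symm6Of E F.codeOf (placementKer S₀)
    have hpos : 0 ≤ nested E (fun X S T => symm6Of (placementKer S₀) (F.codeOf X) (F.codeOf S) (F.codeOf T)) := by
      refine nested_nonneg_of_forall E _ fun X hX S hS => ?_
      have hS' : S ⊆ E := hS.trans sdiff_subset
      have hT : (E \ X) \ S ⊆ E := sdiff_subset.trans sdiff_subset
      rw [symm6Of_placementKer]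
      have := two_mul_codeRows_le_codeSum h₀ (hcode X hX) (hcode S hS') (hcode _ hT) ι hι
      linarith
    linarith
  linarith

/-- **`SpectatorTransfer` for a disjunctive petal of ANY label**: if the petal `ℓ ∈ {1,2,3}` is exactly the family of non-kernel sets
meeting a nonempty `S₀`, then `2·Nabk ℓ ≤ SA + SB + 2·Nkk ℓ` (via the tree's relabelling lemmas `rotate_SA/SB/Nabk/Nkk`). [this work] -/
theorem spectatorTransfer_of_orPetal_label [Fintype α] (ℓ : Fin 5) (hℓ : ℓ = 1 ∨ ℓ = 2 ∨ ℓ = 3) {S₀ : Finset α}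
    (hne : S₀.Nonempty) (h1 : ∀ S : Finset α, (S ∩ S₀).Nonempty → F.lab S = ℓ ∨ F.lab S = 4)
    (h2 : ∀ S : Finset α, F.lab S = ℓ → (S ∩ S₀).Nonempty) :
    2 * F.Nabk ℓ ≤ F.SA + F.SB + 2 * F.Nkk ℓ := by
  rcases hℓ with rfl | rfl | rfl
  · -- label `1`: rotate once (`rot5 1 = 3`)
    have e3 : rot5 1 = 3 := by decide
    rw [← F.rotate_SA, ← F.rotate_SB, ← F.rotate_Nabk 1, ← F.rotate_Nkk 1, e3]
    refine F.rotate.spectatorTransfer_three_of_isOrPetal ⟨hne, fun S hS => ?_, fun S hS => h2 S ?_⟩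
    · rw [F.lab_rotate]
      rcases h1 S hS with e | e <;> rw [e] <;> decide
    · rw [F.lab_rotate] at hS
      revert hS; generalize F.lab S = x; revert x; decide
  · -- label `2`: rotate twice
    have e3 : rot5 (rot5 2) = 3 := by decide
    rw [← F.rotate_SA, ← F.rotate_SB, ← F.rotate_Nabk 2, ← F.rotate_Nkk 2, ← F.rotate.rotate_SA, ← F.rotate.rotate_SB,
      ← F.rotate.rotate_Nabk (rot5 2), ← F.rotate.rotate_Nkk (rot5 2), e3]
    refine F.rotate.rotate.spectatorTransfer_three_of_isOrPetal ⟨hne, fun S hS => ?_, fun S hS => h2 S ?_⟩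
    · rw [F.rotate.lab_rotate, F.lab_rotate]
      rcases h1 S hS with e | e <;> rw [e] <;> decide
    · rw [F.rotate.lab_rotate, F.lab_rotate] at hS
      revert hS; generalize F.lab S = x; revert x; decide
  · exact F.spectatorTransfer_three_of_isOrPetal ⟨hne, h1, h2⟩

end Sunflower

/-- **(♣) for `θ(U₀,U₁,U₂)` with `U_i = OR_{S₀} = {S : S ∩ S₀ ≠ ∅}`** (`S₀ ≠ ∅`, any size), for the petal of that index:
`2·Nabk ≤ SA + SB + 2·Nkk`. [this work] -/
theorem spectatorTransfer_ofUpsets_or [Fintype α] (U : Fin 3 → Finset (Finset α)) (hU : ∀ i, IsUpperSet (U i : Set (Finset α)))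
    (i : Fin 3) {S₀ : Finset α} (hne : S₀.Nonempty) (hUi : ∀ S : Finset α, S ∈ U i ↔ (S ∩ S₀).Nonempty) :
    2 * (ofUpsets U hU).Nabk ⟨i.val + 1, by omega⟩
      ≤ (ofUpsets U hU).SA + (ofUpsets U hU).SB + 2 * (ofUpsets U hU).Nkk ⟨i.val + 1, by omega⟩ := by
  set F := ofUpsets U hU with hF
  have hV : ∀ S : Finset α, (S ∩ S₀).Nonempty → S ∈ F.V i := fun S hS => by
    show S ∈ U i ∪ twoOf U
    exact mem_union_left _ ((hUi S).2 hS)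
  have hback : ∀ S : Finset α, S ∈ F.V i → S ∉ F.A → (S ∩ S₀).Nonempty := fun S hS hA =>
    (hUi S).1 (mem_U_of_mem_ofUpsets_V hU hS hA)
  fin_cases i
  · refine F.spectatorTransfer_of_orPetal_label 1 (Or.inl rfl) hne (fun S hS => (F.lab_V0_iff S).2 (hV S hS)) fun S hS => ?_
    have hSV : S ∈ F.V 0 := (F.lab_V0_iff S).1 (Or.inl hS)
    exact hback S hSV fun hA => by have := (F.lab_eq_four_iff S).2 hA; omega
  · refine F.spectatorTransfer_of_orPetal_label 2 (Or.inr (Or.inl rfl)) hne (fun S hS => (F.lab_V1_iff S).2 (hV S hS)) fun S hS => ?_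
    have hSV : S ∈ F.V 1 := (F.lab_V1_iff S).1 (Or.inl hS)
    exact hback S hSV fun hA => by have := (F.lab_eq_four_iff S).2 hA; omega
  · refine F.spectatorTransfer_of_orPetal_label 3 (Or.inr (Or.inr rfl)) hne (fun S hS => (F.lab_V2_iff S).2 (hV S hS)) fun S hS => ?_
    have hSV : S ∈ F.V 2 := (F.lab_V2_iff S).1 (Or.inl hS)
    exact hback S hSV fun hA => by have := (F.lab_eq_four_iff S).2 hA; omega

end Summit.CriticalPhenomena.PercolationContinuityZ3.Theorems.SunflowerPartition
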